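import Literature.AlgebraicGeometry.ModuliOfAbelianVarieties.SiegelCMReciprocitySimilitude
import HarnessLib

/-!
# CM special pairs of the Siegel datum under `GSp_δ(ℚ)`-conjugation, and the reciprocity law (62) at conjugate pairs

Topic `AlgebraicGeometry/ModuliOfAbelianVarieties`; namespace `Literature.AlgebraicGeometry.ModuliOfAbelianVarieties`.
THEOREMS ONLY (no definition, no named fact, no instance, no `sorry`; debt 0).  Sequel of ★ `SiegelCanonicalModel` ((σ4)-D:
`CMStructure`, `IsSpecial`, `cmRecipMatrix`, `SiegelRationalModel.IsCanonical`) and ★ `SiegelCMReciprocitySimilitude` (R60-1: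
`exists_algHom_extending_actMatrix`, `cmRepMatrix_eq_of_linearMap`).  Cell `hodgecm-mathlib` (D-0151), A-p05's #60 road, leaf
R60-38 (banked generic capital toward row I-7 `SiegelS1`; director g6 RULING s86 (2)(b)).  HC_CM is proved only modulo the 7
printed citations until rung 0 closes.

WHAT IS PROVED ([Deligne1971TravauxShimura] 3.13 / 5.1: it suffices to check the reciprocity law at ONE special point of each
`G(ℚ)`-conjugacy class — «si (62) vaut pour `(T, x)` il vaut pour `(qTq⁻¹, qx)`»; [Milne2005ShimuraVarieties] Rem. 12.9 / Cor. 13.2):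
for a CM structure `c` of type `δ`, a complex structure `J ∈ S^±` with CM types `Φ` and a rational similitude `q ∈ GSp_δ(ℚ)`,
* §1 `CMStructure.IsSpecial.exists_conj` — there is a CM structure `c′` (SAME fields `Kᵢ`, same types `Φ`) with `act′(x) = q·act(x)·q⁻¹`
  and `(c′, qJq⁻¹)` is again a special pair with types `Φ` (∃-phrased: the conjugate structure is built inside the proof —
  injectivity and `[F:ℚ] = 2g` are inherited, `ψ_δ`-adjointness from `ψ_δ(qu, qw) = ν(q)ψ_δ(u, w)`, the eigenline clause by
  transporting eigenvectors along `v ↦ q⁻¹v`);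
* §2 `CMStructure.cmRecipMatrix_eq_conj_of_actMatrix_eq` — the reciprocity element transforms by conjugation:
  `r′(s) = q_𝔸 · r(s) · q_𝔸⁻¹` whenever `act′ = q·act·q⁻¹` (★ `cmRepMatrix_eq_of_linearMap` with `Θ′ = Ad(q_𝔸) ∘ Θ`);
* §3 `SiegelRationalModel.reciprocity_conj_iff` — for any model `R` over `ℚ`, the reciprocity clause (62) of ★ `IsCanonical` at the
  pair `(c′, qJq⁻¹)` (all `E`, `σ`, `s`, `r′`, levels `L`, points `a`) holds IFF it holds at `(c, J)`: `[qJq⁻¹, aL] = [J, q_𝔸⁻¹aL]`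
  (★ `SiegelShimuraSet.mk_conjAct_smul`) and `r′ = q_𝔸 r q_𝔸⁻¹`.  Both clauses are the text of `IsCanonical` verbatim, specialised
  to the pair; no new `Prop` is defined.

## References
* [Deligne1971TravauxShimura] P. Deligne, *Travaux de Shimura*, Sém. Bourbaki 389 (1971): Déf. 3.13 p. 141, 4.18 p. 150, 5.1 p. 153.
* [Milne2005ShimuraVarieties] J. S. Milne, *Introduction to Shimura varieties* (2005): §6 p. 67–70, Def. 12.8 (60)–(62) p. 114,
  Rem. 12.9 p. 115, Cor. 13.2 p. 117, Ex. 12.4 (b) p. 112 (pages of the 2017 revision).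
-/

set_option autoImplicit false

noncomputable section

open Matrix NumberField IsDedekindDomain
open scoped TensorProduct

namespace Literature.AlgebraicGeometry.ModuliOfAbelianVarieties

open Literature.NumberTheory.ComplexMultiplication (traceField ratFiniteAdeleTensorEquiv)
open Literature.AlgebraicGeometry.Motives (CMType)

variable {g : ℕ} {δ : Fin g → ℕ} {ι : Type} [Fintype ι] [DecidableEq ι] {K : ι → Type} [∀ i, Field (K i)]
  [∀ i, NumberField (K i)] [∀ i, IsCMField (K i)]

namespace CMStructure

/-! ### §0. Plumbing: `act` in coordinates, similitudes scale `ψ_δ` -/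

omit [DecidableEq ι] in
/-- `act x v = actMatrix x · v`. [folklore] -/
private theorem act_apply_eq_mulVec (c : CMStructure g δ ι K) (x : Π i, K i) (v : Fin g ⊕ Fin g → ℚ) :
    c.act x v = c.actMatrix x *ᵥ v := by
  rw [actMatrix, LinearMap.toMatrix'_mulVec]

/-- `(A v) · (E w) = v · (Aᵀ E w)`. [folklore] -/
private theorem mulVec_dotProduct_eq {R : Type} [CommRing R] (A E : Matrix (Fin g ⊕ Fin g) (Fin g ⊕ Fin g) R)
    (v w : Fin g ⊕ Fin g → R) : (A *ᵥ v) ⬝ᵥ (E *ᵥ w) = v ⬝ᵥ ((Aᵀ * E) *ᵥ w) := by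
  rw [← Matrix.mulVec_mulVec, Matrix.dotProduct_mulVec v Aᵀ, Matrix.vecMul_transpose]

/-- **A similitude scales the form**: `ψ_δ(qu, qw) = ν·ψ_δ(u, w)` for `ᵀq·E_δ·q = ν·E_δ`. [cite: Milne2005ShimuraVarieties, §6 p. 67] -/
private theorem dotProduct_mulVec_similitude {q : GL (Fin g ⊕ Fin g) ℚ} {ν : ℚˣ}
    (hq : (q : Matrix (Fin g ⊕ Fin g) (Fin g ⊕ Fin g) ℚ)ᵀ * typeFormOver δ ℚ * (q : Matrix (Fin g ⊕ Fin g) (Fin g ⊕ Fin g) ℚ) =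
      (ν : ℚ) • typeFormOver δ ℚ) (u w : Fin g ⊕ Fin g → ℚ) :
    ((q : Matrix (Fin g ⊕ Fin g) (Fin g ⊕ Fin g) ℚ) *ᵥ u) ⬝ᵥ
        (typeFormOver δ ℚ *ᵥ ((q : Matrix (Fin g ⊕ Fin g) (Fin g ⊕ Fin g) ℚ) *ᵥ w)) =
      (ν : ℚ) * (u ⬝ᵥ (typeFormOver δ ℚ *ᵥ w)) := by
  rw [Matrix.mulVec_mulVec, mulVec_dotProduct_eq, ← Matrix.mul_assoc, hq, Matrix.smul_mulVec, dotProduct_smul,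
    smul_eq_mul]

/-- `q (q⁻¹ v) = v`. [folklore] -/
private theorem mulVec_inv_mulVec (q : GL (Fin g ⊕ Fin g) ℚ) (v : Fin g ⊕ Fin g → ℚ) :
    (q : Matrix (Fin g ⊕ Fin g) (Fin g ⊕ Fin g) ℚ) *ᵥ (((q⁻¹ : GL (Fin g ⊕ Fin g) ℚ) : Matrix (Fin g ⊕ Fin g) (Fin g ⊕ Fin g) ℚ) *ᵥ v) =
      v := by
  rw [Matrix.mulVec_mulVec, ← Units.val_mul, mul_inv_cancel, Units.val_one, Matrix.one_mulVec]

/-! ### §1. The conjugate CM structure and the transport of `IsSpecial` -/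

/-- **`GSp_δ(ℚ)`-CONJUGATION OF A CM SPECIAL PAIR** ([Deligne1971TravauxShimura] 3.13 / 5.1; [Milne2005ShimuraVarieties] Rem. 12.9:
`G(ℚ)` permutes the special pairs, `(T, x) ↦ (qTq⁻¹, qx)`): for a CM structure `c` of type `δ` with fields `(Kᵢ)`, a special pair
`(c, J)` with CM types `Φ` and `q ∈ GSp_δ(ℚ)`, there is a CM structure `c′` on the SAME fields with `act′(x) = q·act(x)·q⁻¹` (as
matrices), and `(c′, q•J)` — `q•J = q_ℝ J q_ℝ⁻¹` (★ `conjAct`) — is a special pair with the SAME types `Φ`.  (∃-phrased; the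
structure is assembled in the proof: `ψ_δ`-self-adjointness of `q·act·q⁻¹` from `ψ_δ(qu, qw) = ν(q)·ψ_δ(u, w)`, the commuting clause by
conjugation, the eigenline clause by `v ↦ q⁻¹ v`.) [cite: Deligne1971TravauxShimura, Déf. 3.13 p. 141 and 5.1 p. 153]
[cite: Milne2005ShimuraVarieties, Rem. 12.9 p. 115, Cor. 13.2 p. 117] -/
theorem IsSpecial.exists_conj (c : CMStructure g δ ι K) {J : C0pm δ} {Φ : ∀ i, CMType (K i)} (hc : c.IsSpecial J Φ)
    (q : gspRational δ) :
    ∃ c' : CMStructure g δ ι K,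
      (∀ x, c'.actMatrix x = ((q : GL (Fin g ⊕ Fin g) ℚ) : Matrix (Fin g ⊕ Fin g) (Fin g ⊕ Fin g) ℚ) * c.actMatrix x *
        (((q : GL (Fin g ⊕ Fin g) ℚ)⁻¹ : GL (Fin g ⊕ Fin g) ℚ) : Matrix (Fin g ⊕ Fin g) (Fin g ⊕ Fin g) ℚ)) ∧
      c'.IsSpecial (conjAct δ (gspRationalToReal δ q) J) Φ := by
  obtain ⟨ν, hν⟩ := mem_similitudeGroupOfForm_iff.1 q.2
  -- `v ↦ q v` as a linear automorphism of `ℚ^{2g}` (inverse `v ↦ q⁻¹ v`)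
  let e : (Fin g ⊕ Fin g → ℚ) ≃ₗ[ℚ] (Fin g ⊕ Fin g → ℚ) :=
    LinearEquiv.ofLinear (Matrix.toLin' ((q : GL (Fin g ⊕ Fin g) ℚ) : Matrix (Fin g ⊕ Fin g) (Fin g ⊕ Fin g) ℚ))
      (Matrix.toLin' (((q : GL (Fin g ⊕ Fin g) ℚ)⁻¹ : GL (Fin g ⊕ Fin g) ℚ) : Matrix (Fin g ⊕ Fin g) (Fin g ⊕ Fin g) ℚ))
      (by rw [← Matrix.toLin'_mul, ← Units.val_mul, mul_inv_cancel, Units.val_one, Matrix.toLin'_one])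
      (by rw [← Matrix.toLin'_mul, ← Units.val_mul, inv_mul_cancel, Units.val_one, Matrix.toLin'_one])
  -- the conjugate action and its matrices
  let act' : (Π i, K i) →ₐ[ℚ] Module.End ℚ (Fin g ⊕ Fin g → ℚ) := (e.conjAlgEquiv ℚ).toAlgHom.comp c.act
  have hact' : ∀ x, LinearMap.toMatrix' (act' x) = ((q : GL (Fin g ⊕ Fin g) ℚ) : Matrix (Fin g ⊕ Fin g) (Fin g ⊕ Fin g) ℚ) * c.actMatrix x * (((q : GL (Fin g ⊕ Fin g) ℚ)⁻¹ : GL (Fin g ⊕ Fin g) ℚ) : Matrix (Fin g ⊕ Fin g) (Fin g ⊕ Fin g) ℚ) := by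
    intro x
    change LinearMap.toMatrix' (e.conjAlgEquiv ℚ (c.act x)) = _
    rw [LinearEquiv.conjAlgEquiv_apply, LinearMap.toMatrix'_comp, LinearMap.toMatrix'_comp, ← Matrix.mul_assoc]
    change LinearMap.toMatrix' (Matrix.toLin' ((q : GL (Fin g ⊕ Fin g) ℚ) : Matrix (Fin g ⊕ Fin g) (Fin g ⊕ Fin g) ℚ)) * c.actMatrix x *
      LinearMap.toMatrix' (Matrix.toLin' (((q : GL (Fin g ⊕ Fin g) ℚ)⁻¹ : GL (Fin g ⊕ Fin g) ℚ) : Matrix (Fin g ⊕ Fin g) (Fin g ⊕ Fin g) ℚ)) = _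
    rw [LinearMap.toMatrix'_toLin', LinearMap.toMatrix'_toLin']
  have hact'v : ∀ x v, act' x v = (((q : GL (Fin g ⊕ Fin g) ℚ) : Matrix (Fin g ⊕ Fin g) (Fin g ⊕ Fin g) ℚ) * c.actMatrix x * (((q : GL (Fin g ⊕ Fin g) ℚ)⁻¹ : GL (Fin g ⊕ Fin g) ℚ) : Matrix (Fin g ⊕ Fin g) (Fin g ⊕ Fin g) ℚ)) *ᵥ v := fun x v => by
    rw [← hact', LinearMap.toMatrix'_mulVec]
  -- the conjugate CM structure
  let c' : CMStructure g δ ι K :=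
    { act := act'
      act_injective := (e.conjAlgEquiv ℚ).injective.comp c.act_injective
      sum_finrank_eq := c.sum_finrank_eq
      adjoint := by
        intro x v w
        rw [hact'v, hact'v, ← Matrix.mulVec_mulVec, ← Matrix.mulVec_mulVec, ← Matrix.mulVec_mulVec, ← Matrix.mulVec_mulVec]
        -- `ψ(Q A Q⁻¹ v, w) = ψ(Q A Q⁻¹ v, Q Q⁻¹ w) = ν ψ(A Q⁻¹ v, Q⁻¹ w) = ν ψ(Q⁻¹ v, Ā Q⁻¹ w) = ψ(v, Q Ā Q⁻¹ w)`
        conv_lhs => rw [← mulVec_inv_mulVec (q : GL (Fin g ⊕ Fin g) ℚ) w]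
        rw [dotProduct_mulVec_similitude hν, ← act_apply_eq_mulVec, ← act_apply_eq_mulVec, c.adjoint,
          ← dotProduct_mulVec_similitude hν, mulVec_inv_mulVec] }
  have hc'mat : ∀ x, c'.actMatrix x = ((q : GL (Fin g ⊕ Fin g) ℚ) : Matrix (Fin g ⊕ Fin g) (Fin g ⊕ Fin g) ℚ) * c.actMatrix x * (((q : GL (Fin g ⊕ Fin g) ℚ)⁻¹ : GL (Fin g ⊕ Fin g) ℚ) : Matrix (Fin g ⊕ Fin g) (Fin g ⊕ Fin g) ℚ) := hact'
  -- the images of `q`, `q⁻¹` over `ℝ` and `ℂ`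
  have hQR : ((gspRationalToReal δ q : GL (Fin g ⊕ Fin g) ℝ) : Matrix (Fin g ⊕ Fin g) (Fin g ⊕ Fin g) ℝ) =
      (((q : GL (Fin g ⊕ Fin g) ℚ) : Matrix (Fin g ⊕ Fin g) (Fin g ⊕ Fin g) ℚ)).map (algebraMap ℚ ℝ) := rfl
  have hQiR : (((gspRationalToReal δ q : GL (Fin g ⊕ Fin g) ℝ)⁻¹ : GL (Fin g ⊕ Fin g) ℝ) :
      Matrix (Fin g ⊕ Fin g) (Fin g ⊕ Fin g) ℝ) = ((((q : GL (Fin g ⊕ Fin g) ℚ)⁻¹ : GL (Fin g ⊕ Fin g) ℚ) : Matrix (Fin g ⊕ Fin g) (Fin g ⊕ Fin g) ℚ)).map (algebraMap ℚ ℝ) := by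
    rw [coe_gspRationalToReal, ← map_inv]; rfl
  have hQiQ : ∀ {S : Type} [Field S] [Algebra ℚ S], ((((q : GL (Fin g ⊕ Fin g) ℚ)⁻¹ : GL (Fin g ⊕ Fin g) ℚ) : Matrix (Fin g ⊕ Fin g) (Fin g ⊕ Fin g) ℚ)).map (algebraMap ℚ S) * (((q : GL (Fin g ⊕ Fin g) ℚ) : Matrix (Fin g ⊕ Fin g) (Fin g ⊕ Fin g) ℚ)).map (algebraMap ℚ S) = 1 := by
    intro S _ _
    rw [← Matrix.map_mul, ← Units.val_mul, inv_mul_cancel, Units.val_one, Matrix.map_one _ (map_zero _) (map_one _)]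
  have hQQi : ∀ {S : Type} [Field S] [Algebra ℚ S], (((q : GL (Fin g ⊕ Fin g) ℚ) : Matrix (Fin g ⊕ Fin g) (Fin g ⊕ Fin g) ℚ)).map (algebraMap ℚ S) * ((((q : GL (Fin g ⊕ Fin g) ℚ)⁻¹ : GL (Fin g ⊕ Fin g) ℚ) : Matrix (Fin g ⊕ Fin g) (Fin g ⊕ Fin g) ℚ)).map (algebraMap ℚ S) = 1 := by
    intro S _ _
    rw [← Matrix.map_mul, ← Units.val_mul, mul_inv_cancel, Units.val_one, Matrix.map_one _ (map_zero _) (map_one _)]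
  refine ⟨c', hc'mat, ?_, ?_⟩
  · -- commuting clause over `ℝ`: `(Q J Q⁻¹)(Q A Q⁻¹) = (Q A Q⁻¹)(Q J Q⁻¹)` from `J A = A J`
    intro x
    have hJ := hc.1 x
    rw [coe_conjAct, conjJ_def, hQR, hQiR, hc'mat, Matrix.map_mul, Matrix.map_mul]
    calc (((q : GL (Fin g ⊕ Fin g) ℚ) : Matrix (Fin g ⊕ Fin g) (Fin g ⊕ Fin g) ℚ)).map (algebraMap ℚ ℝ) * (J : Matrix _ _ ℝ) * ((((q : GL (Fin g ⊕ Fin g) ℚ)⁻¹ : GL (Fin g ⊕ Fin g) ℚ) : Matrix (Fin g ⊕ Fin g) (Fin g ⊕ Fin g) ℚ)).map (algebraMap ℚ ℝ) *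
          ((((q : GL (Fin g ⊕ Fin g) ℚ) : Matrix (Fin g ⊕ Fin g) (Fin g ⊕ Fin g) ℚ)).map (algebraMap ℚ ℝ) * (c.actMatrix x).map (algebraMap ℚ ℝ) * ((((q : GL (Fin g ⊕ Fin g) ℚ)⁻¹ : GL (Fin g ⊕ Fin g) ℚ) : Matrix (Fin g ⊕ Fin g) (Fin g ⊕ Fin g) ℚ)).map (algebraMap ℚ ℝ))
        = (((q : GL (Fin g ⊕ Fin g) ℚ) : Matrix (Fin g ⊕ Fin g) (Fin g ⊕ Fin g) ℚ)).map (algebraMap ℚ ℝ) * (J : Matrix _ _ ℝ) * (((((q : GL (Fin g ⊕ Fin g) ℚ)⁻¹ : GL (Fin g ⊕ Fin g) ℚ) : Matrix (Fin g ⊕ Fin g) (Fin g ⊕ Fin g) ℚ)).map (algebraMap ℚ ℝ) * (((q : GL (Fin g ⊕ Fin g) ℚ) : Matrix (Fin g ⊕ Fin g) (Fin g ⊕ Fin g) ℚ)).map (algebraMap ℚ ℝ)) *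
            (c.actMatrix x).map (algebraMap ℚ ℝ) * ((((q : GL (Fin g ⊕ Fin g) ℚ)⁻¹ : GL (Fin g ⊕ Fin g) ℚ) : Matrix (Fin g ⊕ Fin g) (Fin g ⊕ Fin g) ℚ)).map (algebraMap ℚ ℝ) := by simp only [Matrix.mul_assoc]
      _ = (((q : GL (Fin g ⊕ Fin g) ℚ) : Matrix (Fin g ⊕ Fin g) (Fin g ⊕ Fin g) ℚ)).map (algebraMap ℚ ℝ) * ((c.actMatrix x).map (algebraMap ℚ ℝ) * (J : Matrix _ _ ℝ)) *
            ((((q : GL (Fin g ⊕ Fin g) ℚ)⁻¹ : GL (Fin g ⊕ Fin g) ℚ) : Matrix (Fin g ⊕ Fin g) (Fin g ⊕ Fin g) ℚ)).map (algebraMap ℚ ℝ) := by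
          rw [hQiQ, Matrix.mul_one, Matrix.mul_assoc ((((q : GL (Fin g ⊕ Fin g) ℚ) : Matrix (Fin g ⊕ Fin g) (Fin g ⊕ Fin g) ℚ)).map (algebraMap ℚ ℝ)), hJ]
      _ = (((q : GL (Fin g ⊕ Fin g) ℚ) : Matrix (Fin g ⊕ Fin g) (Fin g ⊕ Fin g) ℚ)).map (algebraMap ℚ ℝ) * (c.actMatrix x).map (algebraMap ℚ ℝ) *
            (((((q : GL (Fin g ⊕ Fin g) ℚ)⁻¹ : GL (Fin g ⊕ Fin g) ℚ) : Matrix (Fin g ⊕ Fin g) (Fin g ⊕ Fin g) ℚ)).map (algebraMap ℚ ℝ) * (((q : GL (Fin g ⊕ Fin g) ℚ) : Matrix (Fin g ⊕ Fin g) (Fin g ⊕ Fin g) ℚ)).map (algebraMap ℚ ℝ)) * (J : Matrix _ _ ℝ) * ((((q : GL (Fin g ⊕ Fin g) ℚ)⁻¹ : GL (Fin g ⊕ Fin g) ℚ) : Matrix (Fin g ⊕ Fin g) (Fin g ⊕ Fin g) ℚ)).map (algebraMap ℚ ℝ) := by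
          rw [hQiQ, Matrix.mul_one]; simp only [Matrix.mul_assoc]
      _ = (((q : GL (Fin g ⊕ Fin g) ℚ) : Matrix (Fin g ⊕ Fin g) (Fin g ⊕ Fin g) ℚ)).map (algebraMap ℚ ℝ) * (c.actMatrix x).map (algebraMap ℚ ℝ) * ((((q : GL (Fin g ⊕ Fin g) ℚ)⁻¹ : GL (Fin g ⊕ Fin g) ℚ) : Matrix (Fin g ⊕ Fin g) (Fin g ⊕ Fin g) ℚ)).map (algebraMap ℚ ℝ) *
            ((((q : GL (Fin g ⊕ Fin g) ℚ) : Matrix (Fin g ⊕ Fin g) (Fin g ⊕ Fin g) ℚ)).map (algebraMap ℚ ℝ) * (J : Matrix _ _ ℝ) * ((((q : GL (Fin g ⊕ Fin g) ℚ)⁻¹ : GL (Fin g ⊕ Fin g) ℚ) : Matrix (Fin g ⊕ Fin g) (Fin g ⊕ Fin g) ℚ)).map (algebraMap ℚ ℝ)) := by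
          simp only [Matrix.mul_assoc]
  · -- eigenline clause over `ℂ`: transport the eigenvector along `v ↦ Q_ℂ⁻¹ v`
    intro i ρ v hv
    have hRC : (algebraMap ℝ ℂ) ∘ (algebraMap ℚ ℝ) = algebraMap ℚ ℂ :=
      funext fun x => (IsScalarTower.algebraMap_apply ℚ ℝ ℂ x).symm
    -- `w := Q_ℂ⁻¹ v` is a `ρ`-eigenvector for `c`
    have hvw : v = (((q : GL (Fin g ⊕ Fin g) ℚ) : Matrix (Fin g ⊕ Fin g) (Fin g ⊕ Fin g) ℚ)).map (algebraMap ℚ ℂ) *ᵥ (((((q : GL (Fin g ⊕ Fin g) ℚ)⁻¹ : GL (Fin g ⊕ Fin g) ℚ) : Matrix (Fin g ⊕ Fin g) (Fin g ⊕ Fin g) ℚ)).map (algebraMap ℚ ℂ) *ᵥ v) := by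
      rw [Matrix.mulVec_mulVec, hQQi, Matrix.one_mulVec]
    have hw' : ∀ x : K i, (c.actMatrix (Pi.single i x)).map (algebraMap ℚ ℂ) *ᵥ (((((q : GL (Fin g ⊕ Fin g) ℚ)⁻¹ : GL (Fin g ⊕ Fin g) ℚ) : Matrix (Fin g ⊕ Fin g) (Fin g ⊕ Fin g) ℚ)).map (algebraMap ℚ ℂ) *ᵥ v) =
        ρ x • (((((q : GL (Fin g ⊕ Fin g) ℚ)⁻¹ : GL (Fin g ⊕ Fin g) ℚ) : Matrix (Fin g ⊕ Fin g) (Fin g ⊕ Fin g) ℚ)).map (algebraMap ℚ ℂ) *ᵥ v) := by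
      intro x
      have h := hv x
      rw [hc'mat, Matrix.map_mul, Matrix.map_mul, ← Matrix.mulVec_mulVec, ← Matrix.mulVec_mulVec] at h
      have h2 := congrArg (fun u => ((((q : GL (Fin g ⊕ Fin g) ℚ)⁻¹ : GL (Fin g ⊕ Fin g) ℚ) : Matrix (Fin g ⊕ Fin g) (Fin g ⊕ Fin g) ℚ)).map (algebraMap ℚ ℂ) *ᵥ u) h
      rwa [Matrix.mulVec_mulVec, hQiQ, Matrix.one_mulVec, Matrix.mulVec_smul] at h2
    have hJ' : ((conjAct δ (gspRationalToReal δ q) J : C0pm δ) : Matrix (Fin g ⊕ Fin g) (Fin g ⊕ Fin g) ℝ).map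
          (algebraMap ℝ ℂ) =
        (((q : GL (Fin g ⊕ Fin g) ℚ) : Matrix (Fin g ⊕ Fin g) (Fin g ⊕ Fin g) ℚ)).map (algebraMap ℚ ℂ) * (J : Matrix _ _ ℝ).map (algebraMap ℝ ℂ) * ((((q : GL (Fin g ⊕ Fin g) ℚ)⁻¹ : GL (Fin g ⊕ Fin g) ℚ) : Matrix (Fin g ⊕ Fin g) (Fin g ⊕ Fin g) ℚ)).map (algebraMap ℚ ℂ) := by
      rw [coe_conjAct, conjJ_def, hQR, hQiR, Matrix.map_mul, Matrix.map_mul, Matrix.map_map, Matrix.map_map, hRC]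
    have hQiQw : ((((q : GL (Fin g ⊕ Fin g) ℚ)⁻¹ : GL (Fin g ⊕ Fin g) ℚ) : Matrix (Fin g ⊕ Fin g) (Fin g ⊕ Fin g) ℚ)).map (algebraMap ℚ ℂ) *ᵥ ((((q : GL (Fin g ⊕ Fin g) ℚ) : Matrix (Fin g ⊕ Fin g) (Fin g ⊕ Fin g) ℚ)).map (algebraMap ℚ ℂ) *ᵥ (((((q : GL (Fin g ⊕ Fin g) ℚ)⁻¹ : GL (Fin g ⊕ Fin g) ℚ) : Matrix (Fin g ⊕ Fin g) (Fin g ⊕ Fin g) ℚ)).map (algebraMap ℚ ℂ) *ᵥ v)) =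
        ((((q : GL (Fin g ⊕ Fin g) ℚ)⁻¹ : GL (Fin g ⊕ Fin g) ℚ) : Matrix (Fin g ⊕ Fin g) (Fin g ⊕ Fin g) ℚ)).map (algebraMap ℚ ℂ) *ᵥ v := by
      rw [Matrix.mulVec_mulVec, hQiQ, Matrix.one_mulVec]
    obtain ⟨hpos, hneg⟩ := hc.2 i ρ _ hw'
    refine ⟨fun hρ => ?_, fun hρ => ?_⟩
    · rw [hJ', hvw, ← Matrix.mulVec_mulVec, ← Matrix.mulVec_mulVec, hQiQw, hpos hρ, Matrix.mulVec_smul]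
    · rw [hJ', hvw, ← Matrix.mulVec_mulVec, ← Matrix.mulVec_mulVec, hQiQw, hneg hρ, Matrix.mulVec_smul]

/-! ### §2. The reciprocity element of the conjugate structure: `r′(s) = q_𝔸 · r(s) · q_𝔸⁻¹` -/

/-- **The reciprocity element transforms by conjugation**: if `act′(x) = q·act(x)·q⁻¹` for all `x` (same fields `Kᵢ`), then for
all CM types `Φ`, fields `E` and idèles `s`: `c′.cmRecipMatrix Φ E s = q_𝔸 · c.cmRecipMatrix Φ E s · q_𝔸⁻¹`, `q_𝔸` the diagonal image of
`q` in `GSp_δ(𝔸_f)` (★ `gspRationalToFinAdelic`) — the reflex norms act through `act`, which was conjugated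
(★ `cmRepMatrix_eq_of_linearMap` with `Θ′ = Ad(q_𝔸) ∘ Θ`, `Θ` from ★ `exists_algHom_extending_actMatrix`).
[cite: Deligne1971TravauxShimura, 3.9 p. 140, Déf. 3.13 p. 141] [cite: Milne2005ShimuraVarieties, Def. 12.8 (60)–(61) p. 114] -/
theorem cmRecipMatrix_eq_conj_of_actMatrix_eq (c c' : CMStructure g δ ι K) (q : gspRational δ)
    (h : ∀ x, c'.actMatrix x = ((q : GL (Fin g ⊕ Fin g) ℚ) : Matrix (Fin g ⊕ Fin g) (Fin g ⊕ Fin g) ℚ) * c.actMatrix x *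
      (((q : GL (Fin g ⊕ Fin g) ℚ)⁻¹ : GL (Fin g ⊕ Fin g) ℚ) : Matrix (Fin g ⊕ Fin g) (Fin g ⊕ Fin g) ℚ))
    (Φ : ∀ i, CMType (K i)) (E : IntermediateField ℚ ℂ) [NumberField ↥E] (s : (FiniteAdeleRing (𝓞 ↥E) ↥E)ˣ) :
    c'.cmRecipMatrix Φ E s =
      ((gspRationalToFinAdelic δ q : GL (Fin g ⊕ Fin g) finAdeleQ) : Matrix (Fin g ⊕ Fin g) (Fin g ⊕ Fin g) finAdeleQ) *
        c.cmRecipMatrix Φ E s *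
        (((gspRationalToFinAdelic δ q : GL (Fin g ⊕ Fin g) finAdeleQ)⁻¹ : GL (Fin g ⊕ Fin g) finAdeleQ) :
          Matrix (Fin g ⊕ Fin g) (Fin g ⊕ Fin g) finAdeleQ) := by
  obtain ⟨Θ, hΘ⟩ := c.exists_algHom_extending_actMatrix
  have hQA : ((gspRationalToFinAdelic δ q : GL (Fin g ⊕ Fin g) finAdeleQ) : Matrix (Fin g ⊕ Fin g) (Fin g ⊕ Fin g) finAdeleQ) =
      (((q : GL (Fin g ⊕ Fin g) ℚ) : Matrix (Fin g ⊕ Fin g) (Fin g ⊕ Fin g) ℚ)).map (algebraMap ℚ finAdeleQ) := rfl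
  have hQAi : (((gspRationalToFinAdelic δ q : GL (Fin g ⊕ Fin g) finAdeleQ)⁻¹ : GL (Fin g ⊕ Fin g) finAdeleQ) : Matrix (Fin g ⊕ Fin g) (Fin g ⊕ Fin g) finAdeleQ) =
      ((((q : GL (Fin g ⊕ Fin g) ℚ)⁻¹ : GL (Fin g ⊕ Fin g) ℚ) : Matrix (Fin g ⊕ Fin g) (Fin g ⊕ Fin g) ℚ)).map
        (algebraMap ℚ finAdeleQ) := by
    rw [coe_gspRationalToFinAdelic, ← map_inv]; rfl
  -- `Θ′ := Ad(q_𝔸) ∘ Θ` extends `act′`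
  let Ad : Matrix (Fin g ⊕ Fin g) (Fin g ⊕ Fin g) finAdeleQ →ₗ[finAdeleQ] Matrix (Fin g ⊕ Fin g) (Fin g ⊕ Fin g) finAdeleQ :=
    (LinearMap.mulLeft finAdeleQ ((gspRationalToFinAdelic δ q : GL (Fin g ⊕ Fin g) finAdeleQ) : Matrix (Fin g ⊕ Fin g) (Fin g ⊕ Fin g) finAdeleQ)).comp
      (LinearMap.mulRight finAdeleQ (((gspRationalToFinAdelic δ q : GL (Fin g ⊕ Fin g) finAdeleQ)⁻¹ : GL (Fin g ⊕ Fin g) finAdeleQ) : Matrix (Fin g ⊕ Fin g) (Fin g ⊕ Fin g) finAdeleQ))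
  have hAd : ∀ M, Ad M = ((gspRationalToFinAdelic δ q : GL (Fin g ⊕ Fin g) finAdeleQ) : Matrix (Fin g ⊕ Fin g) (Fin g ⊕ Fin g) finAdeleQ) * M *
      (((gspRationalToFinAdelic δ q : GL (Fin g ⊕ Fin g) finAdeleQ)⁻¹ : GL (Fin g ⊕ Fin g) finAdeleQ) : Matrix (Fin g ⊕ Fin g) (Fin g ⊕ Fin g) finAdeleQ) := fun M => by
    change ((gspRationalToFinAdelic δ q : GL (Fin g ⊕ Fin g) finAdeleQ) : Matrix (Fin g ⊕ Fin g) (Fin g ⊕ Fin g) finAdeleQ) * (M * _) = _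
    rw [Matrix.mul_assoc]
  have hΘ' : ∀ x : Π i, K i, (Ad.comp Θ.toLinearMap) (fun i => (1 : finAdeleQ) ⊗ₜ[ℚ] x i) =
      (c'.actMatrix x).map (algebraMap ℚ finAdeleQ) := by
    intro x
    rw [LinearMap.comp_apply, AlgHom.toLinearMap_apply, hΘ, one_smul, hAd, h, Matrix.map_mul, Matrix.map_mul, hQA, hQAi]
  rw [cmRecipMatrix, cmRecipMatrix, c'.cmRepMatrix_eq_of_linearMap (Ad.comp Θ.toLinearMap) hΘ',
    c.cmRepMatrix_eq_algHom Θ hΘ, LinearMap.comp_apply, AlgHom.toLinearMap_apply, hAd]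

end CMStructure

/-! ### §3. The reciprocity law (62) at conjugate special pairs -/

namespace SiegelRationalModel

open Literature.AlgebraicGeometry.ShimuraVarieties (UnitaryCanonicalModel.IsArtinCorrespondent)

variable {Sg : SiegelComplexRecordSystem g δ}

/-- `[q•J, aL] = [J, q_𝔸⁻¹ a L]` in `Sh_L(GSp_δ, S^±)(ℂ)` (★ `SiegelShimuraSet.mk_conjAct_smul` at `q_𝔸⁻¹ a`).
[cite: Milne2005ShimuraVarieties, §5 p. 57 (the double coset space Sh_K(G,X), q(x,a)k = (qx, qak))] -/
theorem mk_conjAct_eq_mk_inv_mul (L : SiegelLevel δ) (q : gspRational δ) (J : C0pm δ) (a : gspFinAdelic δ) :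
    SiegelShimuraSet.mk δ L.1 (conjAct δ (gspRationalToReal δ q) J) a =
      SiegelShimuraSet.mk δ L.1 J ((gspRationalToFinAdelic δ q)⁻¹ * a) := by
  rw [← SiegelShimuraSet.mk_conjAct_smul δ L.1 q J ((gspRationalToFinAdelic δ q)⁻¹ * a), mul_inv_cancel_left]

/-- **THE RECIPROCITY LAW (62) IS `GSp_δ(ℚ)`-CONJUGATION INVARIANT** ([Deligne1971TravauxShimura] Déf. 3.13 with 5.1 «il suffit de
vérifier (62) en un point spécial de chaque classe de `G(ℚ)`-conjugaison»; [Milne2005ShimuraVarieties] Rem. 12.9, Cor. 13.2): for a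
model `R` of the Siegel tower over `ℚ`, CM structures `c, c′` on the same fields with `act′ = q·act·q⁻¹` for some `q ∈ GSp_δ(ℚ)`,
a complex structure `J` and CM types `Φ`, the reciprocity clause of ★ `IsCanonical` at the pair `(c′, q•J)` — for every number
field `E ⊇ ∏ E*(Φᵢ)`, `σ ∈ Aut(ℂ/E)`, idèle `s` with `art_E(s) = σ|`, every `r′ ∈ GSp_δ(𝔸_f)` with matrix `c′.cmRecipMatrix Φ E s`,
every level `L` and `a`: `σ • [q•J, aL] = [q•J, r′aL]` on `ℚ`-structure points — holds IFF the same clause holds at `(c, J)` with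
`r` of matrix `c.cmRecipMatrix Φ E s`.  (`[q•J, aL] = [J, q_𝔸⁻¹aL]` and `r′ = q_𝔸 r q_𝔸⁻¹`, §2.)  Both sides are the text of
`IsCanonical` :262–277 specialised to the pair. [cite: Deligne1971TravauxShimura, Déf. 3.13 p. 141, 5.1 p. 153]
[cite: Milne2005ShimuraVarieties, Def. 12.8 (62) p. 114, Rem. 12.9 p. 115, Cor. 13.2 p. 117] -/
theorem reciprocity_conj_iff (R : SiegelRationalModel g δ Sg) (c c' : CMStructure g δ ι K) (q : gspRational δ)
    (h : ∀ x, c'.actMatrix x = ((q : GL (Fin g ⊕ Fin g) ℚ) : Matrix (Fin g ⊕ Fin g) (Fin g ⊕ Fin g) ℚ) * c.actMatrix x *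
      (((q : GL (Fin g ⊕ Fin g) ℚ)⁻¹ : GL (Fin g ⊕ Fin g) ℚ) : Matrix (Fin g ⊕ Fin g) (Fin g ⊕ Fin g) ℚ))
    (J : C0pm δ) (Φ : ∀ i, CMType (K i)) :
    (∀ (E : IntermediateField ℚ ℂ) [FiniteDimensional ℚ ↥E], (∀ i, traceField (Φ i) ≤ E) →
      haveI : NumberField ↥E := NumberField.mk
      ∀ (σ : ℂ ≃ₐ[↥E] ℂ) (s : (FiniteAdeleRing (𝓞 ↥E) ↥E)ˣ),
        UnitaryCanonicalModel.IsArtinCorrespondent ↥E (algebraMap ↥E ℂ) s σ.toRingEquiv →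
        ∀ r' : gspFinAdelic δ,
          ((r' : GL (Fin g ⊕ Fin g) (FiniteAdeleRing (𝓞 ℚ) ℚ)) :
              Matrix (Fin g ⊕ Fin g) (Fin g ⊕ Fin g) (FiniteAdeleRing (𝓞 ℚ) ℚ)) = c'.cmRecipMatrix Φ E s →
          ∀ (L : SiegelLevel δ) (a : gspFinAdelic δ),
            (σ.restrictScalars ℚ) • R.ptQ L ((Sg.pts L).symm
                (SiegelShimuraSet.mk δ L.1 (conjAct δ (gspRationalToReal δ q) J) a)) =
              R.ptQ L ((Sg.pts L).symm (SiegelShimuraSet.mk δ L.1 (conjAct δ (gspRationalToReal δ q) J) (r' * a)))) ↔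
    (∀ (E : IntermediateField ℚ ℂ) [FiniteDimensional ℚ ↥E], (∀ i, traceField (Φ i) ≤ E) →
      haveI : NumberField ↥E := NumberField.mk
      ∀ (σ : ℂ ≃ₐ[↥E] ℂ) (s : (FiniteAdeleRing (𝓞 ↥E) ↥E)ˣ),
        UnitaryCanonicalModel.IsArtinCorrespondent ↥E (algebraMap ↥E ℂ) s σ.toRingEquiv →
        ∀ r : gspFinAdelic δ,
          ((r : GL (Fin g ⊕ Fin g) (FiniteAdeleRing (𝓞 ℚ) ℚ)) :
              Matrix (Fin g ⊕ Fin g) (Fin g ⊕ Fin g) (FiniteAdeleRing (𝓞 ℚ) ℚ)) = c.cmRecipMatrix Φ E s →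
          ∀ (L : SiegelLevel δ) (a : gspFinAdelic δ),
            (σ.restrictScalars ℚ) • R.ptQ L ((Sg.pts L).symm (SiegelShimuraSet.mk δ L.1 J a)) =
              R.ptQ L ((Sg.pts L).symm (SiegelShimuraSet.mk δ L.1 J (r * a)))) := by
  set qA : gspFinAdelic δ := gspRationalToFinAdelic δ q with hqA
  constructor
  · intro H E _ hE σ s hσ r hr L a
    haveI : NumberField ↥E := NumberField.mk
    -- `r′ := q_𝔸 r q_𝔸⁻¹` has matrix `c′.cmRecipMatrix Φ E s`
    have hr' : (((qA * r * qA⁻¹ : gspFinAdelic δ) : GL (Fin g ⊕ Fin g) (FiniteAdeleRing (𝓞 ℚ) ℚ)) :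
        Matrix (Fin g ⊕ Fin g) (Fin g ⊕ Fin g) (FiniteAdeleRing (𝓞 ℚ) ℚ)) = c'.cmRecipMatrix Φ E s := by
      rw [c.cmRecipMatrix_eq_conj_of_actMatrix_eq c' q h Φ E s, ← hr, Subgroup.coe_mul, Subgroup.coe_mul, Subgroup.coe_inv,
        Units.val_mul, Units.val_mul]
    have H1 := H E hE σ s hσ (qA * r * qA⁻¹) hr' L (qA * a)
    rwa [SiegelShimuraSet.mk_conjAct_smul, show qA * r * qA⁻¹ * (qA * a) = qA * (r * a) by group,
      SiegelShimuraSet.mk_conjAct_smul] at H1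
  · intro H E _ hE σ s hσ r' hr' L a
    haveI : NumberField ↥E := NumberField.mk
    -- `r := q_𝔸⁻¹ r′ q_𝔸` has matrix `c.cmRecipMatrix Φ E s`
    have hr : (((qA⁻¹ * r' * qA : gspFinAdelic δ) : GL (Fin g ⊕ Fin g) (FiniteAdeleRing (𝓞 ℚ) ℚ)) :
        Matrix (Fin g ⊕ Fin g) (Fin g ⊕ Fin g) (FiniteAdeleRing (𝓞 ℚ) ℚ)) = c.cmRecipMatrix Φ E s := by
      have h' := c.cmRecipMatrix_eq_conj_of_actMatrix_eq c' q h Φ E s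
      rw [← hr', ← hqA] at h'
      have hii : (((qA : GL (Fin g ⊕ Fin g) (FiniteAdeleRing (𝓞 ℚ) ℚ))⁻¹ : GL (Fin g ⊕ Fin g) (FiniteAdeleRing (𝓞 ℚ) ℚ)) :
            Matrix (Fin g ⊕ Fin g) (Fin g ⊕ Fin g) (FiniteAdeleRing (𝓞 ℚ) ℚ)) *
          ((qA : GL (Fin g ⊕ Fin g) (FiniteAdeleRing (𝓞 ℚ) ℚ)) : Matrix (Fin g ⊕ Fin g) (Fin g ⊕ Fin g) (FiniteAdeleRing (𝓞 ℚ) ℚ)) =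
          1 := by
        rw [← Units.val_mul, inv_mul_cancel, Units.val_one]
      rw [Subgroup.coe_mul, Subgroup.coe_mul, Subgroup.coe_inv, Units.val_mul, Units.val_mul, h',
        Matrix.mul_assoc _ (c.cmRecipMatrix Φ E s), ← Matrix.mul_assoc _ _ (c.cmRecipMatrix Φ E s * _), hii, Matrix.one_mul,
        Matrix.mul_assoc, hii, Matrix.mul_one]
    have H1 := H E hE σ s hσ (qA⁻¹ * r' * qA) hr L (qA⁻¹ * a)
    rwa [← mk_conjAct_eq_mk_inv_mul, show qA⁻¹ * r' * qA * (qA⁻¹ * a) = qA⁻¹ * (r' * a) by group,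
      ← mk_conjAct_eq_mk_inv_mul] at H1

end SiegelRationalModel

end Literature.AlgebraicGeometry.ModuliOfAbelianVarieties

end
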